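import Mathlib
import HarnessLib
import Summits.NavierStokesRegularity.NavierStokesRegularity.Theorems.AxisTwistDoorSignConeDefs
import Summits.NavierStokesRegularity.NavierStokesRegularity.Theorems.AxisTwistDoorSignConeToolkit
import Summits.NavierStokesRegularity.NavierStokesRegularity.Theorems.AxisTwistDoorSignConeInterior
import Summits.NavierStokesRegularity.NavierStokesRegularity.Theorems.AxisTwistDoorTiltDominationLocSymmetryExclusions
import Summits.NavierStokesRegularity.NavierStokesRegularity.Theorems.AxisTwistDoorTiltDominationLocRigidity

/-!
# AxisTwistDoor · crux `TiltDominationLoc` (stmt-NavierStokesRegularity-26991) · line «signcone» — WEDGE BOOKKEEPING I: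
# SIGN CONES CONTAINING A LINE (cases (a) «whole plane» and (b) «half-plane» of the planar-wedge rung)

Helper file (`--supports stmt-NavierStokesRegularity-26991 --as helper`; seat ns-imp-p1 g5, DIRECTOR-NS #250 (1); helper names H4/H5
chosen by the LEAD ns-atd-p1 g4, 2026-08-28T17:12Z; line author ns-idea-6 g7).  No definitions.  After the LEAD's reshape v3 the
open dihedral rung of the line is `stub_planarWedgeRigidity`: a core profile with TWO independent one-signed directions `e₃, e`
and a sign cone `K = SignCone w` with EMPTY interior (so `K ⊆ span{e₃, e}`, a closed convex cone in a plane).  Such a planar cone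
either contains a LINE `ℝf` (`f ≠ 0`, `±f ∈ K`: half-plane or whole plane) or is a proper (pointed) wedge.  This file settles
the line cases:

* (from the LEAD's toolkit `…AxisTwistDoorSignConeToolkit.inner_curl_eq_zero_of_mem_neg_mem`, p651921) `f ∈ K` and `−f ∈ K`
  give `⟪curl w(s) y, f⟫ = 0` on the slab;
* `not_isBackwardSingularPoint_of_inner_curl_eq_zero_dir` (H5, the LEAD's exact signature; alias
  `poloidalRigidity_dir_of_poloidalRigidity`) — **POLOIDAL RIGIDITY IN ANY DIRECTION**: the dictionary's `PoloidalRigidity`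
  (W4 = 19708 read at `e₃`, OPEN, taken as a hypothesis) gives, for every `f ≠ 0`, that a class profile with `⟪curl w(s) y, f⟫ ≡ 0`
  is not backward-singular — by conjugating with a determinant-one linear isometry `L`, `L⁻¹e₃ = f/‖f‖` (pattern of
  `…SignConeInterior.not_isBackwardSingularPoint_of_ball_subset_signCone_dir`: `class_conj_linearIsometryEquiv`,
  `inner_curl_conj_linearIsometryEquiv`, `isBackwardSingularPoint_zero_conj`); hence case (b) «`K` contains a line» is
  discharged MODULO the shared stub `stub_noPlanarCollar ⟺ PoloidalRigidity`
  (`not_isBackwardSingularPoint_of_line_subset_signCone`, `…_of_stubNoPlanarCollar`);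
* `not_isBackwardSingularPoint_of_plane_subset_signCone` (H4) — **case (a) «whole plane» IS REGULAR, unconditionally**:
  `±e₃, ±e ∈ K` ⇒ `ω ⊥ e₃` and `ω ⊥ e` pointwise ⇒ on every slice the vorticity is parallel to the fixed vector
  `b = (−e₁, e₀, 0) = e₃ × e ≠ 0` ⇒ regular apex by the LEAD's `…SymmetryExclusions.not_isBackwardSingularPoint_of_curl_parallel_slice`
  (Barker–Prange vorticity-direction rigidity in the Type-I class).

HONEST FRAMING: kinematic bookkeeping on HYPOTHETICAL one-signed Type-I profiles; (H5) is CONDITIONAL on `PoloidalRigidity` (open, W4);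
nothing here proves the planar-wedge rung, the wall `stub_rayRigidity`, crux 26991, the leaf or any NS regularity statement (Clay A OPEN).
-/

noncomputable section

-- the summit and its single sub-problem share the name (CONVENTIONS §1), as in every Theorems file
set_option linter.dupNamespace false

namespace Summit.NavierStokesRegularity.NavierStokesRegularity.Theorems.AxisTwistDoorSignConeWedgeLines

open Set Function Filter Topology MeasureTheory Metric
open scoped InnerProductSpace RealInnerProductSpace
open Literature.Analysis Literature.Analysis.FluidPDE
open Summit.NavierStokesRegularity.NavierStokesRegularity.Theorems
open Summit.NavierStokesRegularity.NavierStokesRegularity.Theorems.AxisTwistDoorSignConeDefs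
open Summit.NavierStokesRegularity.NavierStokesRegularity.Theorems.AxisTwistDoorSignConeToolkit
  (inner_curl_eq_zero_of_mem_neg_mem)
open Summit.NavierStokesRegularity.NavierStokesRegularity.Theorems.AxisTwistDoorTiltDominationLocDefs
open Summit.NavierStokesRegularity.NavierStokesRegularity.Theorems.AxisTwistDoorTiltDominationLocEnergyClass
  (poloidalRigidity_iff_typeI)
open Summit.NavierStokesRegularity.NavierStokesRegularity.Theorems.AxisTwistDoorTiltDominationLocRigidity
  (stubNoPlanarCollar_iff_poloidalRigidity)

variable {C : ℝ} {v : ℝ → EuclideanSpace ℝ (Fin 3) → EuclideanSpace ℝ (Fin 3)}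

/-! ### §1 (H5) Poloidal rigidity in any direction — case (b) «the sign cone contains a line» modulo W4 -/

/-- **(H5) `PoloidalRigidity` rotated to an arbitrary direction.**  If the dictionary's `PoloidalRigidity` holds (energy-class
profiles with `ω₃ ≡ 0` are not backward-singular; W4, OPEN — a HYPOTHESIS here), then for every `f ≠ 0` a profile of the
four-hypothesis class with `⟪curl v(s) y, f⟫ = 0` on the slab is not backward-singular at the apex: conjugate by a determinant-one
linear isometry `L` with `L⁻¹ e₃ = f/‖f‖`; the class, the vanishing component (pseudovector law, `det L = 1`) and the apex
singularity are covariant. [cite: KochNadirashviliSereginSverak2009, Thm 5.2 (rotation covariance of the ancient class)] -/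
theorem not_isBackwardSingularPoint_of_inner_curl_eq_zero_dir (hP : AxisTwistDoorTiltDominationLocDefs.PoloidalRigidity)
    {f : EuclideanSpace ℝ (Fin 3)} (hf : f ≠ 0) {C : ℝ} {w : ℝ → EuclideanSpace ℝ (Fin 3) → EuclideanSpace ℝ (Fin 3)}
    (hrate : HasTypeITimeDecay C w) (hcont : ContinuousOn (uncurry w) (Iio (0 : ℝ) ×ˢ univ))
    (hmild : ∀ s t : ℝ, s < t → t < 0 → ∀ x,
      w t x = UnboundedOperators.heatExtension (w s) (t - s) x - oseenDuhamel 1 s w w t x)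
    (hdiv : ∀ t < 0, VectorCalculus.IsDivFree (w t))
    (hzero : ∀ s < (0 : ℝ), ∀ y, ⟪curl (w s) y, f⟫_ℝ = 0) :
    ¬ IsBackwardSingularPoint w 0 := by
  intro hsing
  obtain ⟨L, hL, hdet⟩ :=
    HalfSpaceWindowDoorCirculationCarryingRigidityRotate.exists_linearIsometryEquiv_det_one_symm_single_two hf
  obtain ⟨hrate', hcont', hmild', hdiv'⟩ :=
    PoloidalWindowDoorPoloidalWindowRigidityRotate.class_conj_linearIsometryEquiv L hrate hcont hmild hdiv
  have hsing' := RellichScarSimilarityCovariance.LIE.isBackwardSingularPoint_zero_conj L hsing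
  refine poloidalRigidity_iff_typeI.1 hP C _ hrate' hcont' hmild' hdiv' (fun s hs y => ?_) hsing'
  -- the pseudovector law with `det L = 1`, at the direction `e₃ = L (L⁻¹ e₃)`, `L⁻¹ e₃ = f/‖f‖`
  have hkey : ⟪curl (fun z => L (w s (L.symm z))) y, EuclideanSpace.single (2 : Fin 3) (1 : ℝ)⟫_ℝ =
      ⟪curl (w s) (L.symm y), L.symm (EuclideanSpace.single (2 : Fin 3) (1 : ℝ))⟫_ℝ := by
    have h := inner_curl_conj_linearIsometryEquiv L (w s) y (L.symm (EuclideanSpace.single (2 : Fin 3) (1 : ℝ)))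
    rw [LinearIsometryEquiv.apply_symm_apply, hdet, one_mul] at h
    exact h
  show ⟪curl (fun z => L (w s (L.symm z))) y, EuclideanSpace.single (2 : Fin 3) (1 : ℝ)⟫_ℝ = 0
  rw [hkey, hL, real_inner_smul_right, hzero s hs (L.symm y), mul_zero]

/-- Alias of `not_isBackwardSingularPoint_of_inner_curl_eq_zero_dir` in the «PoloidalRigidity rotated» reading. [folklore] -/
theorem poloidalRigidity_dir_of_poloidalRigidity (hPR : PoloidalRigidity) {f : EuclideanSpace ℝ (Fin 3)} (hf : f ≠ 0)
    (hrate : HasTypeITimeDecay C v) (hcont : ContinuousOn (uncurry v) (Iio (0 : ℝ) ×ˢ univ))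
    (hmild : ∀ s t : ℝ, s < t → t < 0 → ∀ x,
      v t x = UnboundedOperators.heatExtension (v s) (t - s) x - oseenDuhamel 1 s v v t x)
    (hdiv : ∀ t < 0, VectorCalculus.IsDivFree (v t))
    (hpol : ∀ s < (0 : ℝ), ∀ y : EuclideanSpace ℝ (Fin 3), ⟪curl (v s) y, f⟫_ℝ = 0) :
    ¬ IsBackwardSingularPoint v 0 :=
  not_isBackwardSingularPoint_of_inner_curl_eq_zero_dir hPR hf hrate hcont hmild hdiv hpol

/-- **Case (b) of the planar-wedge rung, modulo W4.**  If the sign cone of a class profile contains a LINE (`f ≠ 0` with `f` and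
`−f` one-signed), then — granted `PoloidalRigidity` — the apex is not backward-singular. [folklore] -/
theorem not_isBackwardSingularPoint_of_line_subset_signCone (hPR : PoloidalRigidity)
    (hrate : HasTypeITimeDecay C v) (hcont : ContinuousOn (uncurry v) (Iio (0 : ℝ) ×ˢ univ))
    (hmild : ∀ s t : ℝ, s < t → t < 0 → ∀ x,
      v t x = UnboundedOperators.heatExtension (v s) (t - s) x - oseenDuhamel 1 s v v t x)
    (hdiv : ∀ t < 0, VectorCalculus.IsDivFree (v t))
    {f : EuclideanSpace ℝ (Fin 3)} (hf : f ≠ 0) (hpos : f ∈ SignCone v) (hneg : -f ∈ SignCone v) :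
    ¬ IsBackwardSingularPoint v 0 :=
  poloidalRigidity_dir_of_poloidalRigidity hPR hf hrate hcont hmild hdiv (inner_curl_eq_zero_of_mem_neg_mem hpos hneg)

/-- The same with the line's registered shared stub `StubNoPlanarCollar` (⟺ `PoloidalRigidity`,
`…TiltDominationLocRigidity.stubNoPlanarCollar_iff_poloidalRigidity`) as the hypothesis, for `IsCore` profiles. [folklore] -/
theorem not_isBackwardSingularPoint_of_line_subset_signCone_of_stubNoPlanarCollar (h₀ : StubNoPlanarCollar)
    {w : ℝ → EuclideanSpace ℝ (Fin 3) → EuclideanSpace ℝ (Fin 3)} (hw : IsCore C w)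
    {f : EuclideanSpace ℝ (Fin 3)} (hf : f ≠ 0) (hpos : f ∈ SignCone w) (hneg : -f ∈ SignCone w) :
    ¬ IsBackwardSingularPoint w 0 :=
  not_isBackwardSingularPoint_of_line_subset_signCone (stubNoPlanarCollar_iff_poloidalRigidity.mp h₀)
    hw.1 hw.2.1 hw.2.2.1 hw.2.2.2 hf hpos hneg

/-! ### §2 (H4) Case (a) «the sign cone contains the plane `span{e₃, e}`» is regular, unconditionally -/

/-- A vector orthogonal to `e₃` and to `e = (e₀, e₁, e₂)` with `(e₀, e₁) ≠ (0, 0)` is an explicit multiple of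
`b = (−e₁, e₀, 0)` (`= e₃ × e`). [folklore] -/
theorem eq_smul_of_inner_e3_eq_zero_of_inner_eq_zero {e x : EuclideanSpace ℝ (Fin 3)} (he : e 0 ≠ 0 ∨ e 1 ≠ 0)
    (h3 : ⟪x, EuclideanSpace.single (2 : Fin 3) (1 : ℝ)⟫_ℝ = 0) (hx : ⟪x, e⟫_ℝ = 0) :
    x = ((x 1 * e 0 - x 0 * e 1) / (e 0 ^ 2 + e 1 ^ 2)) •
      (WithLp.toLp 2 ![-(e 1), e 0, 0] : EuclideanSpace ℝ (Fin 3)) := by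
  have hx2 : x 2 = 0 := by
    rw [EuclideanSpace.inner_single_right] at h3
    simpa using h3
  have hsum : x 0 * e 0 + x 1 * e 1 = 0 := by
    have h : ⟪x, e⟫_ℝ = x 0 * e 0 + x 1 * e 1 + x 2 * e 2 := by
      rw [PiLp.inner_apply, Fin.sum_univ_three]
      simp only [RCLike.inner_apply, conj_trivial]
      ring
    rw [hx, hx2, zero_mul, add_zero] at h
    linarith
  have hN : e 0 ^ 2 + e 1 ^ 2 ≠ 0 := by
    rcases he with h | h
    · have := sq_pos_of_ne_zero h; positivity
    · have := sq_pos_of_ne_zero h; positivity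
  ext i
  fin_cases i
  · simp only [Fin.zero_eta, Fin.isValue, PiLp.smul_apply, smul_eq_mul]
    simp
    field_simp
    linear_combination (e 0) * hsum
  · simp only [Fin.mk_one, Fin.isValue, PiLp.smul_apply, smul_eq_mul]
    simp
    field_simp
    linear_combination (e 1) * hsum
  · simp [hx2]

/-- **(H4) Case (a) of the planar-wedge rung is regular.**  If the sign cone of a profile of the four-hypothesis class contains
`e₃, −e₃, e, −e` with `e ∉ ℝe₃` (i.e. the whole plane `span{e₃, e}`), then `ω ⊥ e₃` and `ω ⊥ e` on the slab, so on every slice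
the vorticity is parallel to the fixed vector `e₃ × e ≠ 0`, and the apex is NOT backward-singular by the vorticity-direction
rigidity of the class (`…SymmetryExclusions.not_isBackwardSingularPoint_of_curl_parallel_slice`, Barker–Prange).
[cite: BarkerPrange2020, Prop. 4 and Rem. 5] -/
theorem not_isBackwardSingularPoint_of_plane_subset_signCone (hrate : HasTypeITimeDecay C v)
    (hcont : ContinuousOn (uncurry v) (Iio (0 : ℝ) ×ˢ univ))
    (hmild : ∀ s t : ℝ, s < t → t < 0 → ∀ x,
      v t x = UnboundedOperators.heatExtension (v s) (t - s) x - oseenDuhamel 1 s v v t x)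
    (hdiv : ∀ t < 0, VectorCalculus.IsDivFree (v t))
    {e : EuclideanSpace ℝ (Fin 3)} (hind : ∀ c : ℝ, e ≠ c • EuclideanSpace.single (2 : Fin 3) (1 : ℝ))
    (h₃ : EuclideanSpace.single (2 : Fin 3) (1 : ℝ) ∈ SignCone v)
    (h₃' : -EuclideanSpace.single (2 : Fin 3) (1 : ℝ) ∈ SignCone v)
    (he : e ∈ SignCone v) (he' : -e ∈ SignCone v) :
    ¬ IsBackwardSingularPoint v 0 := by
  -- `(e₀, e₁) ≠ (0, 0)` since `e ∉ ℝ e₃`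
  have hne : e 0 ≠ 0 ∨ e 1 ≠ 0 := by
    by_contra h
    push Not at h
    refine hind (e 2) ?_
    ext i
    fin_cases i <;> simp [h.1, h.2]
  -- the fixed direction `b = e₃ × e ≠ 0`
  set b : EuclideanSpace ℝ (Fin 3) := WithLp.toLp 2 ![-(e 1), e 0, 0] with hb
  have hb0 : b ≠ 0 := by
    intro h0
    have h0' : b 0 = 0 ∧ b 1 = 0 := by rw [h0]; simp
    simp only [hb] at h0'
    simp at h0'
    rcases hne with h | h
    · exact h h0'.2
    · exact h h0'.1
  refine AxisTwistDoorTiltDominationLocSymmetryExclusions.not_isBackwardSingularPoint_of_curl_parallel_slice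
    hrate hcont hmild hdiv (s₀ := -1) (by norm_num) hb0 fun y => ?_
  exact ⟨_, eq_smul_of_inner_e3_eq_zero_of_inner_eq_zero hne
    (inner_curl_eq_zero_of_mem_neg_mem h₃ h₃' (-1) (by norm_num) y)
    (inner_curl_eq_zero_of_mem_neg_mem he he' (-1) (by norm_num) y)⟩

/-- Case (a) with the `IsCore` bundle of the line's vocabulary. [folklore] -/
theorem not_isBackwardSingularPoint_of_plane_subset_signCone_core {w : ℝ → EuclideanSpace ℝ (Fin 3) → EuclideanSpace ℝ (Fin 3)}
    (hw : IsCore C w) {e : EuclideanSpace ℝ (Fin 3)} (hind : ∀ c : ℝ, e ≠ c • EuclideanSpace.single (2 : Fin 3) (1 : ℝ))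
    (h₃ : EuclideanSpace.single (2 : Fin 3) (1 : ℝ) ∈ SignCone w)
    (h₃' : -EuclideanSpace.single (2 : Fin 3) (1 : ℝ) ∈ SignCone w)
    (he : e ∈ SignCone w) (he' : -e ∈ SignCone w) :
    ¬ IsBackwardSingularPoint w 0 :=
  not_isBackwardSingularPoint_of_plane_subset_signCone hw.1 hw.2.1 hw.2.2.1 hw.2.2.2 hind h₃ h₃' he he'

end Summit.NavierStokesRegularity.NavierStokesRegularity.Theorems.AxisTwistDoorSignConeWedgeLines

end
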